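import Summits.QuantumFields.QCD.Theses.QuarksAsStableAction
import Summits.QuantumFields.QCD.Theses.WilsonQuarkChessboard
import Literature.MathematicalPhysics.QuantumLattice.WilsonDiracAP
import Literature.Probability.LatticeModels.TorusFourierProofs
import Summits.QuantumFields.QCD.Theorems.HeatSlicedQuarksFreeKernelPowerCountingFourier

/-!
# Stub `stub_freeTwistedFourier` of line `Sketch` (idea `free-tangent-landau-chessboard`) — auxiliary file
(crux `Summit.QuantumFields.QCD.Theses.QuarksAsStableAction.WilsonQuarkStability`, item stmt-QuantumFields-9736,
route route-QuantumFields-QuarksAsStableAction)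

The model-independent half of the torus-Fourier inversion of a translation-invariant lattice Dirac
operator on `(ℤ/L)⁴ × colour (Fin 3) × spin (Fin 4)`:

* `Abstract`: for square complex matrices, if `Pᴴ P = 1` and `(A P)ᴴ (A P) = diagonal d` with a real,
  nowhere-vanishing `d`, then `AᴴA = P · diagonal d · Pᴴ`, `det A ≠ 0`,
  `(AᴴA)⁻¹ = P · diagonal (1/d) · Pᴴ` and `A⁻¹ = P · diagonal (1/d) · (AP)ᴴ` (`Matrix.inv_eq_left_inv`),
  with their entrywise forms;
* `PlaneWave`: with the unitary plane-wave matrix `P = F ⊗ 1`, `F(x,k) = L⁻² χ_k(x)`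
  (`planeP_conjTranspose_mul_self` of `HeatSlicedQuarksFreeKernelPowerCountingFourier`), if
  `A P = Q`, `Q(p,q) = F(p.1,q.1) · (1 ⊗ N(q.1))(p.2,q.2)` for spin blocks with `N(k)ᴴ N(k) = d(k)·1`,
  then `Qᴴ Q = diagonal (d ∘ fst)` (character orthogonality), hence `det A ≠ 0`,
  `(AᴴA)⁻¹((x,s),(y,s')) = δ_{ss'} L⁻⁴ Σ_k χ_k(x) conj χ_k(y) / d(k)` and
  `A⁻¹((x,a,α),(y,b,β)) = δ_{ab} L⁻⁴ Σ_k χ_k(x) conj χ_k(y) (N(k)ᴴ)_{αβ} / d(k)`.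

The companion file `…StubFreeTwistedFourier.lean` feeds in the free Wilson–Dirac operator of a constant
central `U(3)` link.  References: Montvay–Münster, *Quantum Fields on a Lattice* §4.2 (free Wilson
fermions in momentum space); folklore linear algebra.  Pure theorem file (no `def`s).
-/

namespace Summit.QuantumFields.QCD.Cruxes.WilsonQuarkStability.FreeTangentLandauChessboard

open Literature.MathematicalPhysics Literature.MathematicalPhysics.QuantumLattice
  Literature.MathematicalPhysics.QuantumFieldTheory Literature.Probability.LatticeModels
open Matrix Complex
open scoped Kronecker ComplexOrder ComplexConjugate BigOperators
open Summit.QuantumFields.QCD.Theorems.HeatSlicedQuarks.FreeKernel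

noncomputable section

/-! ### Abstract step: inverses of `A` and `AᴴA` from a unitary diagonalisation of `A P` -/

section Abstract

variable {ι : Type*} [Fintype ι] [DecidableEq ι]

/-- If `Pᴴ P = 1` and `(A P)ᴴ (A P) = diagonal d`, then `AᴴA = P · diagonal d · Pᴴ`. -/
theorem conjTranspose_mul_self_eq_of_diag (P A : Matrix ι ι ℂ) (d : ι → ℝ)
    (hP : Pᴴ * P = 1) (hd : (A * P)ᴴ * (A * P) = diagonal fun q => ((d q : ℝ) : ℂ)) :
    Aᴴ * A = P * diagonal (fun q => ((d q : ℝ) : ℂ)) * Pᴴ := by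
  have hinv : P⁻¹ = Pᴴ := Matrix.inv_eq_left_inv hP
  have hdet : IsUnit P.det := Matrix.isUnit_det_of_left_inverse hP
  have hPP : P * Pᴴ = 1 := by rw [← hinv]; exact Matrix.mul_nonsing_inv P hdet
  have h1 : Pᴴ * (Aᴴ * A) * P = diagonal fun q => ((d q : ℝ) : ℂ) := by
    rw [← hd, conjTranspose_mul]
    simp only [Matrix.mul_assoc]
  calc Aᴴ * A = (P * Pᴴ) * (Aᴴ * A) * (P * Pᴴ) := by rw [hPP, Matrix.one_mul, Matrix.mul_one]
    _ = P * (Pᴴ * (Aᴴ * A) * P) * Pᴴ := by simp only [Matrix.mul_assoc]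
    _ = P * diagonal (fun q => ((d q : ℝ) : ℂ)) * Pᴴ := by rw [h1]

/-- If `Pᴴ P = 1`, `(A P)ᴴ (A P) = diagonal d` and `d` vanishes nowhere, then `det A ≠ 0`. -/
theorem det_ne_zero_of_diag (P A : Matrix ι ι ℂ) (d : ι → ℝ)
    (hd : (A * P)ᴴ * (A * P) = diagonal fun q => ((d q : ℝ) : ℂ)) (hd0 : ∀ q, d q ≠ 0) :
    A.det ≠ 0 := by
  intro hA
  have h0 : ((A * P)ᴴ * (A * P)).det = 0 := by
    rw [det_mul, det_mul, hA, zero_mul, mul_zero]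
  rw [hd, det_diagonal] at h0
  exact (Finset.prod_ne_zero_iff.mpr fun q _ => Complex.ofReal_ne_zero.mpr (hd0 q)) h0

/-- The key cancellation: `P · diagonal (1/d) · Pᴴ · (AᴴA) = 1`. -/
theorem planeInv_mul_conjTranspose_mul_self (P A : Matrix ι ι ℂ) (d : ι → ℝ)
    (hP : Pᴴ * P = 1) (hd : (A * P)ᴴ * (A * P) = diagonal fun q => ((d q : ℝ) : ℂ))
    (hd0 : ∀ q, d q ≠ 0) :
    P * diagonal (fun q => (((d q : ℝ) : ℂ))⁻¹) * Pᴴ * (Aᴴ * A) = 1 := by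
  have hinv : P⁻¹ = Pᴴ := Matrix.inv_eq_left_inv hP
  have hdet : IsUnit P.det := Matrix.isUnit_det_of_left_inverse hP
  have hPP : P * Pᴴ = 1 := by rw [← hinv]; exact Matrix.mul_nonsing_inv P hdet
  have hdd : diagonal (fun q => (((d q : ℝ) : ℂ))⁻¹) * diagonal (fun q => ((d q : ℝ) : ℂ)) = 1 := by
    rw [diagonal_mul_diagonal, ← diagonal_one]
    congr 1
    funext q
    exact inv_mul_cancel₀ (Complex.ofReal_ne_zero.mpr (hd0 q))
  rw [conjTranspose_mul_self_eq_of_diag P A d hP hd]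
  calc P * diagonal (fun q => (((d q : ℝ) : ℂ))⁻¹) * Pᴴ * (P * diagonal (fun q => ((d q : ℝ) : ℂ)) * Pᴴ)
      = P * diagonal (fun q => (((d q : ℝ) : ℂ))⁻¹) * (Pᴴ * P) * diagonal (fun q => ((d q : ℝ) : ℂ)) * Pᴴ := by
        simp only [Matrix.mul_assoc]
    _ = 1 := by rw [hP, Matrix.mul_one, Matrix.mul_assoc P, hdd, Matrix.mul_one, hPP]

/-- `(AᴴA)⁻¹ = P · diagonal (1/d) · Pᴴ` whenever `Pᴴ P = 1`, `(A P)ᴴ (A P) = diagonal d` and `d ≠ 0`. -/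
theorem inv_conjTranspose_mul_self_eq (P A : Matrix ι ι ℂ) (d : ι → ℝ)
    (hP : Pᴴ * P = 1) (hd : (A * P)ᴴ * (A * P) = diagonal fun q => ((d q : ℝ) : ℂ))
    (hd0 : ∀ q, d q ≠ 0) :
    (Aᴴ * A)⁻¹ = P * diagonal (fun q => (((d q : ℝ) : ℂ))⁻¹) * Pᴴ :=
  Matrix.inv_eq_left_inv (planeInv_mul_conjTranspose_mul_self P A d hP hd hd0)

/-- `A⁻¹ = P · diagonal (1/d) · (A P)ᴴ` whenever `Pᴴ P = 1`, `(A P)ᴴ (A P) = diagonal d` and `d ≠ 0`. -/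
theorem inv_eq_of_diag (P A : Matrix ι ι ℂ) (d : ι → ℝ)
    (hP : Pᴴ * P = 1) (hd : (A * P)ᴴ * (A * P) = diagonal fun q => ((d q : ℝ) : ℂ))
    (hd0 : ∀ q, d q ≠ 0) :
    A⁻¹ = P * diagonal (fun q => (((d q : ℝ) : ℂ))⁻¹) * (A * P)ᴴ := by
  refine Matrix.inv_eq_left_inv ?_
  rw [conjTranspose_mul, ← Matrix.mul_assoc, Matrix.mul_assoc _ Aᴴ A]
  exact planeInv_mul_conjTranspose_mul_self P A d hP hd hd0

/-- Entrywise form: `(AᴴA)⁻¹(i,j) = Σ_q P(i,q) d(q)⁻¹ conj P(j,q)`. -/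
theorem inv_conjTranspose_mul_self_apply (P A : Matrix ι ι ℂ) (d : ι → ℝ)
    (hP : Pᴴ * P = 1) (hd : (A * P)ᴴ * (A * P) = diagonal fun q => ((d q : ℝ) : ℂ))
    (hd0 : ∀ q, d q ≠ 0) (i j : ι) :
    (Aᴴ * A)⁻¹ i j = ∑ q, P i q * (((d q : ℝ) : ℂ))⁻¹ * conj (P j q) := by
  rw [inv_conjTranspose_mul_self_eq P A d hP hd hd0, Matrix.mul_apply]
  refine Finset.sum_congr rfl fun q _ => ?_
  rw [Matrix.mul_diagonal, Matrix.conjTranspose_apply, Complex.star_def]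

/-- Entrywise form: `A⁻¹(i,j) = Σ_q P(i,q) d(q)⁻¹ conj ((AP)(j,q))`. -/
theorem inv_apply_of_diag (P A : Matrix ι ι ℂ) (d : ι → ℝ)
    (hP : Pᴴ * P = 1) (hd : (A * P)ᴴ * (A * P) = diagonal fun q => ((d q : ℝ) : ℂ))
    (hd0 : ∀ q, d q ≠ 0) (i j : ι) :
    A⁻¹ i j = ∑ q, P i q * (((d q : ℝ) : ℂ))⁻¹ * conj ((A * P) j q) := by
  rw [inv_eq_of_diag P A d hP hd hd0, Matrix.mul_apply]
  refine Finset.sum_congr rfl fun q _ => ?_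
  rw [Matrix.mul_diagonal, Matrix.conjTranspose_apply, Complex.star_def]

end Abstract

/-! ### Plane waves on `(ℤ/L)⁴ × colour × spin`: inverses from a normalised colour–spin symbol -/

section PlaneWave

variable {L : ℕ} [NeZero L]

/-- **`Qᴴ Q` is diagonal**: if every spin block is normalised, `N(k)ᴴ N(k) = d(k)·1`, the matrix
`Q(p,q) = F(p.1,q.1) · (1 ⊗ N(q.1))(p.2,q.2)`, `F(x,k) = L⁻² χ_k(x)`, has `Qᴴ Q = diagonal (d ∘ fst)`
(plane-wave orthonormality `Fᴴ F = 1` in the site factor). -/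
theorem symQ_conjTranspose_mul_self_of (N : TorusSite 4 L → Matrix (Fin 4) (Fin 4) ℂ)
    (d : TorusSite 4 L → ℝ) (hN : ∀ k, (N k)ᴴ * N k = ((d k : ℝ) : ℂ) • (1 : Matrix (Fin 4) (Fin 4) ℂ)) :
    (Matrix.of fun p q : TorusSite 4 L × Fin 3 × Fin 4 =>
        (Matrix.of fun x k : TorusSite 4 L => ((L : ℂ) ^ 2)⁻¹ * torusChar k x) p.1 q.1 *
          ((1 : Matrix (Fin 3) (Fin 3) ℂ) ⊗ₖ N q.1) p.2 q.2)ᴴ *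
        (Matrix.of fun p q : TorusSite 4 L × Fin 3 × Fin 4 =>
          (Matrix.of fun x k : TorusSite 4 L => ((L : ℂ) ^ 2)⁻¹ * torusChar k x) p.1 q.1 *
            ((1 : Matrix (Fin 3) (Fin 3) ℂ) ⊗ₖ N q.1) p.2 q.2) =
      diagonal fun q : TorusSite 4 L × Fin 3 × Fin 4 => ((d q.1 : ℝ) : ℂ) := by
  ext q q'
  obtain ⟨k, s₀⟩ := q
  obtain ⟨k', s₀'⟩ := q'
  rw [Matrix.mul_apply, Fintype.sum_prod_type, Matrix.diagonal_apply]
  have hs : ∀ (x : TorusSite 4 L) (s : Fin 3 × Fin 4),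
      (Matrix.of fun p q : TorusSite 4 L × Fin 3 × Fin 4 =>
          (Matrix.of fun x k : TorusSite 4 L => ((L : ℂ) ^ 2)⁻¹ * torusChar k x) p.1 q.1 *
            ((1 : Matrix (Fin 3) (Fin 3) ℂ) ⊗ₖ N q.1) p.2 q.2)ᴴ (k, s₀) (x, s) *
        (Matrix.of fun p q : TorusSite 4 L × Fin 3 × Fin 4 =>
          (Matrix.of fun x k : TorusSite 4 L => ((L : ℂ) ^ 2)⁻¹ * torusChar k x) p.1 q.1 *
            ((1 : Matrix (Fin 3) (Fin 3) ℂ) ⊗ₖ N q.1) p.2 q.2) (x, s) (k', s₀') =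
        ((Matrix.of fun x k : TorusSite 4 L => ((L : ℂ) ^ 2)⁻¹ * torusChar k x)ᴴ k x *
            (Matrix.of fun x k : TorusSite 4 L => ((L : ℂ) ^ 2)⁻¹ * torusChar k x) x k') *
          ((((1 : Matrix (Fin 3) (Fin 3) ℂ) ⊗ₖ N k)ᴴ s₀ s) * (((1 : Matrix (Fin 3) (Fin 3) ℂ) ⊗ₖ N k') s s₀')) := by
    intro x s
    simp only [Matrix.conjTranspose_apply, Matrix.of_apply, star_mul']
    ring
  simp_rw [hs]
  rw [← Finset.sum_mul_sum, ← Matrix.mul_apply, ← Matrix.mul_apply, planeF_conjTranspose_mul_self,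
    Matrix.one_apply]
  by_cases hk : k = k'
  · subst hk
    rw [if_pos rfl, one_mul, conjTranspose_kronecker, ← mul_kronecker_mul, conjTranspose_one,
      Matrix.one_mul, hN, Matrix.kronecker_smul, one_kronecker_one, Matrix.smul_apply, Matrix.one_apply,
      smul_eq_mul, mul_ite, mul_one, mul_zero]
    simp only [Prod.mk.injEq, true_and]
  · rw [if_neg hk, zero_mul, if_neg (fun h => hk (Prod.mk.injEq _ _ _ _ ▸ h).1)]

/-- If `A P = Q` (`P = F ⊗ 1` the plane-wave matrix, `Q` as in `symQ_conjTranspose_mul_self_of`) with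
normalised spin blocks `N(k)ᴴ N(k) = d(k)·1` and `d` vanishing nowhere, then `det A ≠ 0`. -/
theorem det_ne_zero_of_planeWave (N : TorusSite 4 L → Matrix (Fin 4) (Fin 4) ℂ) (d : TorusSite 4 L → ℝ)
    (hN : ∀ k, (N k)ᴴ * N k = ((d k : ℝ) : ℂ) • (1 : Matrix (Fin 4) (Fin 4) ℂ)) (hd0 : ∀ k, d k ≠ 0)
    (A : Matrix (TorusSite 4 L × Fin 3 × Fin 4) (TorusSite 4 L × Fin 3 × Fin 4) ℂ)
    (hA : A * ((Matrix.of fun x k : TorusSite 4 L => ((L : ℂ) ^ 2)⁻¹ * torusChar k x) ⊗ₖ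
        (1 : Matrix (Fin 3 × Fin 4) (Fin 3 × Fin 4) ℂ)) =
      Matrix.of fun p q : TorusSite 4 L × Fin 3 × Fin 4 =>
        (Matrix.of fun x k : TorusSite 4 L => ((L : ℂ) ^ 2)⁻¹ * torusChar k x) p.1 q.1 *
          ((1 : Matrix (Fin 3) (Fin 3) ℂ) ⊗ₖ N q.1) p.2 q.2) :
    A.det ≠ 0 := by
  have hd : (A * ((Matrix.of fun x k : TorusSite 4 L => ((L : ℂ) ^ 2)⁻¹ * torusChar k x) ⊗ₖ
        (1 : Matrix (Fin 3 × Fin 4) (Fin 3 × Fin 4) ℂ)))ᴴ *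
      (A * ((Matrix.of fun x k : TorusSite 4 L => ((L : ℂ) ^ 2)⁻¹ * torusChar k x) ⊗ₖ
        (1 : Matrix (Fin 3 × Fin 4) (Fin 3 × Fin 4) ℂ))) =
      diagonal fun q : TorusSite 4 L × Fin 3 × Fin 4 => ((d q.1 : ℝ) : ℂ) := by
    rw [hA]; exact symQ_conjTranspose_mul_self_of N d hN
  exact det_ne_zero_of_diag _ A (fun q => d q.1) hd fun q => hd0 q.1

/-- **`(AᴴA)⁻¹` in Fourier variables**: under the hypotheses of `det_ne_zero_of_planeWave`,
`(AᴴA)⁻¹((x,s),(y,s')) = δ_{ss'} · L⁻⁴ Σ_k χ_k(x) conj χ_k(y) / d(k)`. -/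
theorem inv_gram_apply_of_planeWave (N : TorusSite 4 L → Matrix (Fin 4) (Fin 4) ℂ) (d : TorusSite 4 L → ℝ)
    (hN : ∀ k, (N k)ᴴ * N k = ((d k : ℝ) : ℂ) • (1 : Matrix (Fin 4) (Fin 4) ℂ)) (hd0 : ∀ k, d k ≠ 0)
    (A : Matrix (TorusSite 4 L × Fin 3 × Fin 4) (TorusSite 4 L × Fin 3 × Fin 4) ℂ)
    (hA : A * ((Matrix.of fun x k : TorusSite 4 L => ((L : ℂ) ^ 2)⁻¹ * torusChar k x) ⊗ₖ
        (1 : Matrix (Fin 3 × Fin 4) (Fin 3 × Fin 4) ℂ)) =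
      Matrix.of fun p q : TorusSite 4 L × Fin 3 × Fin 4 =>
        (Matrix.of fun x k : TorusSite 4 L => ((L : ℂ) ^ 2)⁻¹ * torusChar k x) p.1 q.1 *
          ((1 : Matrix (Fin 3) (Fin 3) ℂ) ⊗ₖ N q.1) p.2 q.2)
    (p q : TorusSite 4 L × Fin 3 × Fin 4) :
    (Aᴴ * A)⁻¹ p q =
      if p.2 = q.2 then ((L : ℂ) ^ 4)⁻¹ * ∑ k, torusChar k p.1 * conj (torusChar k q.1) / ((d k : ℝ) : ℂ)
      else 0 := by
  set P : Matrix (TorusSite 4 L × Fin 3 × Fin 4) (TorusSite 4 L × Fin 3 × Fin 4) ℂ :=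
    ((Matrix.of fun x k : TorusSite 4 L => ((L : ℂ) ^ 2)⁻¹ * torusChar k x) ⊗ₖ
        (1 : Matrix (Fin 3 × Fin 4) (Fin 3 × Fin 4) ℂ)) with hP
  have hd : (A * P)ᴴ * (A * P) = diagonal fun q : TorusSite 4 L × Fin 3 × Fin 4 => ((d q.1 : ℝ) : ℂ) := by
    rw [hA]; exact symQ_conjTranspose_mul_self_of N d hN
  have hPu : Pᴴ * P = 1 := by rw [hP]; exact planeP_conjTranspose_mul_self
  obtain ⟨x, sa⟩ := p
  obtain ⟨y, sb⟩ := q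
  rw [inv_conjTranspose_mul_self_apply P A (fun q => d q.1) hPu hd (fun q => hd0 q.1),
    Fintype.sum_prod_type]
  dsimp only
  have hs : ∀ (k : TorusSite 4 L) (s : Fin 3 × Fin 4),
      P (x, sa) (k, s) * (((d k : ℝ) : ℂ))⁻¹ * conj (P (y, sb) (k, s)) =
        ((L : ℂ) ^ 4)⁻¹ * (torusChar k x * conj (torusChar k y) / ((d k : ℝ) : ℂ)) *
          ((1 : Matrix (Fin 3 × Fin 4) (Fin 3 × Fin 4) ℂ) sa s *
            (1 : Matrix (Fin 3 × Fin 4) (Fin 3 × Fin 4) ℂ) s sb) := by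
    intro k s
    rw [hP, Matrix.kroneckerMap_apply, Matrix.kroneckerMap_apply, Matrix.of_apply, Matrix.of_apply,
      map_mul, map_mul, conj_one_apply, map_inv₀, map_pow, map_natCast]
    ring
  simp_rw [hs]
  rw [← Finset.sum_mul_sum, ← Matrix.mul_apply, Matrix.one_mul, Matrix.one_apply, mul_ite, mul_one,
    mul_zero, ← Finset.mul_sum]

/-- **`A⁻¹` in Fourier variables**: under the hypotheses of `det_ne_zero_of_planeWave`,
`A⁻¹((x,a,α),(y,b,β)) = δ_{ab} · L⁻⁴ Σ_k χ_k(x) conj χ_k(y) (N(k)ᴴ)_{αβ} / d(k)` (`A⁻¹ = P·diag(1/d)·Qᴴ`). -/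
theorem inv_apply_of_planeWave (N : TorusSite 4 L → Matrix (Fin 4) (Fin 4) ℂ) (d : TorusSite 4 L → ℝ)
    (hN : ∀ k, (N k)ᴴ * N k = ((d k : ℝ) : ℂ) • (1 : Matrix (Fin 4) (Fin 4) ℂ)) (hd0 : ∀ k, d k ≠ 0)
    (A : Matrix (TorusSite 4 L × Fin 3 × Fin 4) (TorusSite 4 L × Fin 3 × Fin 4) ℂ)
    (hA : A * ((Matrix.of fun x k : TorusSite 4 L => ((L : ℂ) ^ 2)⁻¹ * torusChar k x) ⊗ₖ
        (1 : Matrix (Fin 3 × Fin 4) (Fin 3 × Fin 4) ℂ)) =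
      Matrix.of fun p q : TorusSite 4 L × Fin 3 × Fin 4 =>
        (Matrix.of fun x k : TorusSite 4 L => ((L : ℂ) ^ 2)⁻¹ * torusChar k x) p.1 q.1 *
          ((1 : Matrix (Fin 3) (Fin 3) ℂ) ⊗ₖ N q.1) p.2 q.2)
    (p q : TorusSite 4 L × Fin 3 × Fin 4) :
    A⁻¹ p q =
      if p.2.1 = q.2.1 then
        ((L : ℂ) ^ 4)⁻¹ * ∑ k, torusChar k p.1 * conj (torusChar k q.1) * (N k)ᴴ p.2.2 q.2.2 / ((d k : ℝ) : ℂ)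
      else 0 := by
  set P : Matrix (TorusSite 4 L × Fin 3 × Fin 4) (TorusSite 4 L × Fin 3 × Fin 4) ℂ :=
    ((Matrix.of fun x k : TorusSite 4 L => ((L : ℂ) ^ 2)⁻¹ * torusChar k x) ⊗ₖ
        (1 : Matrix (Fin 3 × Fin 4) (Fin 3 × Fin 4) ℂ)) with hP
  have hd : (A * P)ᴴ * (A * P) = diagonal fun q : TorusSite 4 L × Fin 3 × Fin 4 => ((d q.1 : ℝ) : ℂ) := by
    rw [hA]; exact symQ_conjTranspose_mul_self_of N d hN
  have hPu : Pᴴ * P = 1 := by rw [hP]; exact planeP_conjTranspose_mul_self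
  obtain ⟨x, a, α⟩ := p
  obtain ⟨y, b, β⟩ := q
  rw [inv_apply_of_diag P A (fun q => d q.1) hPu hd (fun q => hd0 q.1), hA, Fintype.sum_prod_type]
  dsimp only
  have hs : ∀ (k : TorusSite 4 L) (s : Fin 3 × Fin 4),
      P (x, a, α) (k, s) * (((d k : ℝ) : ℂ))⁻¹ *
          conj ((Matrix.of fun p q : TorusSite 4 L × Fin 3 × Fin 4 =>
            (Matrix.of fun x k : TorusSite 4 L => ((L : ℂ) ^ 2)⁻¹ * torusChar k x) p.1 q.1 *
              ((1 : Matrix (Fin 3) (Fin 3) ℂ) ⊗ₖ N q.1) p.2 q.2) (y, b, β) (k, s)) =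
        ((L : ℂ) ^ 4)⁻¹ * (torusChar k x * conj (torusChar k y) / ((d k : ℝ) : ℂ)) *
          ((1 : Matrix (Fin 3 × Fin 4) (Fin 3 × Fin 4) ℂ) (a, α) s *
            ((1 : Matrix (Fin 3) (Fin 3) ℂ) ⊗ₖ N k)ᴴ s (b, β)) := by
    intro k s
    rw [Matrix.conjTranspose_apply, Complex.star_def]
    simp only [hP, Matrix.kroneckerMap_apply, Matrix.of_apply, map_mul, conj_one_apply, map_inv₀, map_pow,
      map_natCast]
    ring
  simp_rw [hs, ← Finset.mul_sum, ← Matrix.mul_apply, Matrix.one_mul, conjTranspose_kronecker,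
    conjTranspose_one, Matrix.kroneckerMap_apply, Matrix.one_apply]
  split_ifs with hab
  · rw [Finset.mul_sum]
    refine Finset.sum_congr rfl fun k _ => ?_
    ring
  · simp

end PlaneWave

end

end Summit.QuantumFields.QCD.Cruxes.WilsonQuarkStability.FreeTangentLandauChessboard
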